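import Summits.QuantumFields.YangMills.Theorems.FluctuationComparisonRegPrIntLS2BetaRelativeTowerSupBudget128
import Summits.QuantumFields.YangMills.Theorems.FluctuationComparisonRegPrIntLS2BetaResidualGauge
import Summits.QuantumFields.YangMills.Theorems.FluctuationComparisonRegPrIntLS2BetaHFlatOfRelativeLetter
import HarnessLib

/-!
# S2β · THE SUP CHAIN, (LIFT-LAD′) — THE ARC PROFILE OF THE TWO `AxStage` STAGE TOWERS FROM THE DATUM'S SMALL-BOND GUARD (the `hArc` input of
# ✓p831621 `combRow'`): COMB-ROW′'s residue IS the D-GUARD item, by name (px12 lineage, FILE C)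

Cell `ym3-torus` (YM ladder rung R3 = continuum `SU(2)` Yang–Mills on the three-torus at fixed lattice data — a RUNG: NOT d = 4, NOT infinite volume, NOT a mass gap,
NOT Clay).  Width seat «width 12» `ym3-torus-px12` (gen 26), FREE px helper on crux `stmt-QuantumFields-20520`; LINE g18-1 S2β, the pairing lane's sup chain:
(ST′) ⟸ {(TOP-LAD′), COMB-ROW′, NC-ROW′, (SCT′-c)} (px10 g25 ✓p831454 `supTower_of_combNcRowsFb₃'`); COMB-ROW′ ⟸ {AxStage clauses, `2 ≤ L`, `hArc`} (✓p831621 `combRow'`).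
`--kind proof --supports stmt-QuantumFields-20520 --as helper`, count-neutral, DEFINITION-FREE (0 `def`, 0 `instance`, 0 `notation`, 0 `sorry`, default heartbeats).

WHY.  `combRow'` takes the ARC PROFILE `hArc` — «the two stage towers `U′_i := g_i • M^iW`, `U₁′_i := g₀_i • M^iU₁` have bond arcs `≤ σ ≤ ¼` at every internal height
`1 ≤ i < K − J`» — as a HYPOTHESIS; it is necessary in kind (the hat lift is linear in the LOGS of the individual coarse fields) and it is NOT derivable from `AxStage` +
`histGood` alone (the lane's one-level sup step ✓`arc_le_sup_step_hatLift` is a contraction `s_i ≤ L⁻¹s_{i+1} + ρ_i + C₂s_{i+1}²` with a basin `M(L) ≈ 10⁻²`, not a decay from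
an O(1) start).  What supplies it is this lineage's ✓`…RelativeTowerSupBudget128.exists_gamma_supBudget_128` (px12 g24): under the datum's explicit small-bond guard
`arc(V e) ≤ 1∕128`, `histGood(θBal b₀ p₀)` and `γ ≤ γ₁(L, b₀, p₀)`, EVERY gauged level of a stage tower over a good history in the fibre of `V` has arcs `≤ ¼`.
THIS FILE docks that letter to `combRow'`'s `hArc`, for BOTH towers:
* §1 ★★ `arcProfile_of_smallBond` — the `hArc` text of ✓`combRow'` with `σ := 1∕4`, for two good histories `W, U₁ ∈ fibre(V) ∩ histGood(θBal)` and their stage towers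
  `(g, W)`, `(g₀, U₁)` given by the `AxStage` clause texts (hat weights, hat lift, (T1) top, (T4) comb axiality, (T5) one-step consistency), `γ ≤ γ₁(L, b₀, p₀)`.
* §2 ★★★ `arcProfile_of_smallBond_axStage` — the same with `U₁`'s two memberships DERIVED from `U₀`'s (`U₀ ∈ fibre(V) ∩ histGood`) through the `AxStage` bottom relation
  `U₀ = (g_0⁻¹·g₀_0) • U₁` and the residual clauses (T6)∕(T5-res) (✓`residual_of_iter_eq`, ✓`gaugeAct_mem_fibre_iff_of_residual`, ✓`gaugeAct_mem_histGood_iff`) — the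
  inputs an inhabitant of COMB-ROW′ at the census knit's `θ := θBal` level HAS (datum guard `G ∧ «arc ≤ 1∕128»`, the pair's `AxStage` witness).
⇒ COMB-ROW′ ⟸ {the datum's small-bond guard (D-GUARD, UV3-NODE §84.9∕§90), θBal-summability, `γ ≤ γ₁`} by name: its residue is the SAME gap-list item as the (D)-side's.

HONEST SCOPE.  Prefix plumbing over landed letters by name; nothing of Bałaban's renormalisation-group analysis is asserted or proved ([Balaban1985RegularSpaces] Lemma 1
(1.24)–(1.26) p.79, (1.29) p.81, (1.65) p.87 — the printed one-level axial sizes; [Balaban1985UV3] (7) p.257 — the small-field history); the small-bond guard on the datum is a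
HYPOTHESIS and is NOT suppliable as a `∀ F ∀ J` letter at coarse `J` (toron obstruction, ✓`…SmallBondGaugeToronObstruction`, UV3-NODE §90); NC-ROW′, (TOP-LAD′), (SCT′),
(ST′)∕(ST″)∕(ST), LOC, GAP♯∘ (`stub_uniformFibreGapOrbit`, registry 3732b7df UNTOUCHED), the five registered stubs (0∕5), S2β, 20520, 19936, 19200, `YM3TorusSU2` are NOT proved;
no registered stub is closed; rung R3 — NOT d = 4, NOT infinite volume, NOT a mass gap, NOT Clay; the Yang–Mills mass gap is NOT proved.
-/

set_option autoImplicit false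

noncomputable section

namespace Summit.QuantumFields.YangMills.Theorems.FluctuationComparisonRegPrIntLS2BetaLiftLadderArcProfile

open Finset
open scoped Real
open Literature.MathematicalPhysics.QuantumLattice (su2Quat)
open Literature.MathematicalPhysics.QuantumFieldTheory.Balaban1983to89
open T4Continuum T3ContinuumYM3Torus T3UnitScaleTilt T3TiltDescent T3LevelShift BlockAveraging
open T4CubeChartGnomonic (SU2)
open T4HaarSU2ExpChart (expPoint)
open T4ExpWindowSmallField (logVec)
open T3UnitLawDensityEML (ℰp)
open T3ConstrainedMinimiser (fibre)
open B10Eq27TorusAxialLog (rel axialT)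
open Summit.QuantumFields.YangMills.Theorems.FluctuationComparisonRegPrIntLS2BetaRelativeTowerSupBudget128 (exists_gamma_supBudget_128)
open Summit.QuantumFields.YangMills.Theorems.FluctuationComparisonRegPrIntLS2BetaResidualGauge
  (gaugeAct_mul_eq gaugeAct_inv_gaugeAct gaugeAct_mem_fibre_iff_of_residual gaugeAct_mem_histGood_iff)
open Summit.QuantumFields.YangMills.Theorems.FluctuationComparisonRegPrIntLS2BetaHFlatOfRelativeLetter (residual_of_iter_eq)

/-! ## §1 The arc profile of two stage towers over a small-bond datum -/

/-- ★★ **THE ARC PROFILE `hArc` OF ✓`combRow'` FROM THE DATUM'S SMALL-BOND GUARD, BOTH TOWERS**: for `γ ≤ γ₁(L, b₀, p₀)`, a datum `V` with bond arcs `≤ 1∕128`, two good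
histories `W, U₁ ∈ fibre(V) ∩ histGood(θBal b₀ p₀)`, and stage towers `(g, W)`, `(g₀, U₁)` over the geodesic hat lift (the `AxStage` clause texts: hat weights `wt`, lift
formula, (T1), (T4), (T5) for each tower), every gauged level `1 ≤ i < K − J` of either tower has bond arcs `≤ 1∕4` (✓`exists_gamma_supBudget_128` applied twice).
[cite: Balaban1985RegularSpaces, Lemma 1 (1.24)-(1.26) p.79, (1.29) p.81, (1.65) p.87; Balaban1985UV3, (7) p.257] -/
theorem arcProfile_of_smallBond (L : ℕ) (hL : 1 < L) (b₀ p₀ : ℝ) (hb : 0 < b₀) (hp : 0 < p₀) :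
    ∃ γ₁ : ℝ, 0 < γ₁ ∧ ∀ (F : T3Family) (γ : ℝ), F.L = L → 0 < γ → γ ≤ γ₁ →
      ∀ (J K : ℕ) (hJK : J ≤ K) (V : GaugeField (F.P J) 0 SU2), (∀ e, ‖logVec (su2Quat (V e))‖ ≤ 1 / 128) →
      ∀ (W U₁ : GaugeField (F.P K) 0 SU2), W ∈ fibre F ℰp J K hJK V → W ∈ histGood F ℰp (θBal F.L γ b₀ p₀) K J →
        U₁ ∈ fibre F ℰp J K hJK V → U₁ ∈ histGood F ℰp (θBal F.L γ b₀ p₀) K J →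
      ∀ (wt : (j : ℕ) → PBond (F.P K) j → PBond (F.P K) (j + 1) → ℝ)
        (lift : (j : ℕ) → GaugeField (F.P K) (j + 1) SU2 → GaugeField (F.P K) j SU2) (g g₀ : (j : ℕ) → Site (F.P K) j → SU2),
        (∀ j b e, wt j b e = if e.dir = b.dir ∧ (b.src b.dir - emb e.src b.dir).val < (F.P K).L then
          ∏ ν ∈ Finset.univ.erase b.dir, max 0 (1 - ((rel (emb e.src) b.src ν).natAbs : ℝ) / (F.P K).L) else 0) →
        (∀ j X b, lift j X b = expPoint (∑ e, wt j b e • ((((F.P K).L : ℕ) : ℝ)⁻¹ • logVec (su2Quat (X e))))) →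
        (∀ j, K - J ≤ j → ∀ y, g j y = 1) →
        (∀ j, j < K - J → ∀ x,
          axialT (GaugeField.gaugeAct (g j) (Averaging.iter (fun k => blockAvg (P := F.P K) (j := k) ℰp) j W)) (emb (blockOf x)) x =
            axialT (lift j (GaugeField.gaugeAct (g (j + 1)) (Averaging.iter (fun k => blockAvg (P := F.P K) (j := k) ℰp) (j + 1) W))) (emb (blockOf x)) x) →
        (∀ j, j < K - J →
          (blockAvg (P := F.P K) (j := j) ℰp).avg (GaugeField.gaugeAct (g j) (Averaging.iter (fun k => blockAvg (P := F.P K) (j := k) ℰp) j W)) =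
            GaugeField.gaugeAct (g (j + 1)) (Averaging.iter (fun k => blockAvg (P := F.P K) (j := k) ℰp) (j + 1) W)) →
        (∀ j, K - J ≤ j → ∀ y, g₀ j y = 1) →
        (∀ j, j < K - J → ∀ x,
          axialT (GaugeField.gaugeAct (g₀ j) (Averaging.iter (fun k => blockAvg (P := F.P K) (j := k) ℰp) j U₁)) (emb (blockOf x)) x =
            axialT (lift j (GaugeField.gaugeAct (g₀ (j + 1)) (Averaging.iter (fun k => blockAvg (P := F.P K) (j := k) ℰp) (j + 1) U₁))) (emb (blockOf x)) x) →
        (∀ j, j < K - J →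
          (blockAvg (P := F.P K) (j := j) ℰp).avg (GaugeField.gaugeAct (g₀ j) (Averaging.iter (fun k => blockAvg (P := F.P K) (j := k) ℰp) j U₁)) =
            GaugeField.gaugeAct (g₀ (j + 1)) (Averaging.iter (fun k => blockAvg (P := F.P K) (j := k) ℰp) (j + 1) U₁)) →
        ∀ i, 1 ≤ i → i < K - J → ∀ e : PBond (F.P K) i,
          ‖logVec (su2Quat (GaugeField.gaugeAct (g i) (Averaging.iter (fun k => blockAvg (P := F.P K) (j := k) ℰp) i W) e))‖ ≤ 1 / 4 ∧
          ‖logVec (su2Quat (GaugeField.gaugeAct (g₀ i) (Averaging.iter (fun k => blockAvg (P := F.P K) (j := k) ℰp) i U₁) e))‖ ≤ 1 / 4 := by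
  obtain ⟨E, _hE, γ₁, hγ₁, H⟩ := exists_gamma_supBudget_128 L hL b₀ p₀ hb hp
  refine ⟨γ₁, hγ₁, ?_⟩
  intro F γ hFL hγ hγ₁' J K hJK V hV W U₁ hWf hWg hU₁f hU₁g wt lift g g₀ hwt hlift hT1 hT4 hT5 hT1' hT4' hT5' i hi1 hiK e
  -- the first tower `(g, W)`
  obtain ⟨s, _hs0, hs, hs4, _, _⟩ := H F γ hFL hγ hγ₁' J K hJK V hV W hWf hWg g wt
    (fun t => lift t (GaugeField.gaugeAct (g (t + 1)) (Averaging.iter (fun k => blockAvg (P := F.P K) (j := k) ℰp) (t + 1) W)))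
    (fun t _ b e => hwt t b e) (fun t _ b => hlift t _ b) hT1 (fun t ht z => hT4 t ht z) (fun t ht => hT5 t ht)
  -- the second tower `(g₀, U₁)`
  obtain ⟨s', _hs0', hs', hs4', _, _⟩ := H F γ hFL hγ hγ₁' J K hJK V hV U₁ hU₁f hU₁g g₀ wt
    (fun t => lift t (GaugeField.gaugeAct (g₀ (t + 1)) (Averaging.iter (fun k => blockAvg (P := F.P K) (j := k) ℰp) (t + 1) U₁)))
    (fun t _ b e => hwt t b e) (fun t _ b => hlift t _ b) hT1' (fun t ht z => hT4' t ht z) (fun t ht => hT5' t ht)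
  exact ⟨(hs i hiK.le e).trans (hs4 i hiK.le), (hs' i hiK.le e).trans (hs4' i hiK.le)⟩

/-! ## §2 The same with the second tower's memberships derived from the `AxStage` bottom relation -/

/-- ★★★ **THE ARC PROFILE FROM THE DATUM'S SMALL-BOND GUARD, `AxStage` EDITION**: as §1, but for the pair `(W, U₀)` with `U₀ ∈ fibre(V) ∩ histGood(θBal)` and the FULL
`AxStage` witness `(wt, lift, U₁, g, g₀)` — the fibre mate `U₁`'s two memberships are DERIVED from `U₀ = (g_0⁻¹·g₀_0) • U₁` and the residual clauses (T6) for `g`,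
(T5-res) for `g₀` (the transformation `g_0⁻¹·g₀_0` is residual: ✓`residual_of_iter_eq`; fibres and `histGood` are invariant: ✓`gaugeAct_mem_fibre_iff_of_residual`,
✓`gaugeAct_mem_histGood_iff`).  The conclusion is ✓p831621 `combRow'`'s hypothesis `hArc` with `σ := 1∕4`.
[cite: Balaban1985RegularSpaces, Lemma 1 (1.24)-(1.26) p.79, (1.29) p.81; Balaban1985Variational, (3)-(4) p.278; Balaban1985UV3, (7) p.257] -/
theorem arcProfile_of_smallBond_axStage (L : ℕ) (hL : 1 < L) (b₀ p₀ : ℝ) (hb : 0 < b₀) (hp : 0 < p₀) :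
    ∃ γ₁ : ℝ, 0 < γ₁ ∧ ∀ (F : T3Family) (γ : ℝ), F.L = L → 0 < γ → γ ≤ γ₁ →
      ∀ (J K : ℕ) (hJK : J ≤ K) (V : GaugeField (F.P J) 0 SU2), (∀ e, ‖logVec (su2Quat (V e))‖ ≤ 1 / 128) →
      ∀ (W U₀ : GaugeField (F.P K) 0 SU2), W ∈ fibre F ℰp J K hJK V → W ∈ histGood F ℰp (θBal F.L γ b₀ p₀) K J →
        U₀ ∈ fibre F ℰp J K hJK V → U₀ ∈ histGood F ℰp (θBal F.L γ b₀ p₀) K J →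
      ∀ (wt : (j : ℕ) → PBond (F.P K) j → PBond (F.P K) (j + 1) → ℝ)
        (lift : (j : ℕ) → GaugeField (F.P K) (j + 1) SU2 → GaugeField (F.P K) j SU2)
        (U₁ : GaugeField (F.P K) 0 SU2) (g g₀ : (j : ℕ) → Site (F.P K) j → SU2),
        (∀ j b e, wt j b e = if e.dir = b.dir ∧ (b.src b.dir - emb e.src b.dir).val < (F.P K).L then
          ∏ ν ∈ Finset.univ.erase b.dir, max 0 (1 - ((rel (emb e.src) b.src ν).natAbs : ℝ) / (F.P K).L) else 0) →
        (∀ j X b, lift j X b = expPoint (∑ e, wt j b e • ((((F.P K).L : ℕ) : ℝ)⁻¹ • logVec (su2Quat (X e))))) →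
        (∀ j, K - J ≤ j → ∀ y, g j y = 1) →
        (∀ j, j < K - J → ∀ x,
          axialT (GaugeField.gaugeAct (g j) (Averaging.iter (fun k => blockAvg (P := F.P K) (j := k) ℰp) j W)) (emb (blockOf x)) x =
            axialT (lift j (GaugeField.gaugeAct (g (j + 1)) (Averaging.iter (fun k => blockAvg (P := F.P K) (j := k) ℰp) (j + 1) W))) (emb (blockOf x)) x) →
        (∀ j, j < K - J →
          (blockAvg (P := F.P K) (j := j) ℰp).avg (GaugeField.gaugeAct (g j) (Averaging.iter (fun k => blockAvg (P := F.P K) (j := k) ℰp) j W)) =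
            GaugeField.gaugeAct (g (j + 1)) (Averaging.iter (fun k => blockAvg (P := F.P K) (j := k) ℰp) (j + 1) W)) →
        (∀ j, K - J ≤ j → ∀ y, g₀ j y = 1) →
        (∀ j, j < K - J → ∀ x,
          axialT (GaugeField.gaugeAct (g₀ j) (Averaging.iter (fun k => blockAvg (P := F.P K) (j := k) ℰp) j U₁)) (emb (blockOf x)) x =
            axialT (lift j (GaugeField.gaugeAct (g₀ (j + 1)) (Averaging.iter (fun k => blockAvg (P := F.P K) (j := k) ℰp) (j + 1) U₁))) (emb (blockOf x)) x) →
        (∀ j, j < K - J →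
          (blockAvg (P := F.P K) (j := j) ℰp).avg (GaugeField.gaugeAct (g₀ j) (Averaging.iter (fun k => blockAvg (P := F.P K) (j := k) ℰp) j U₁)) =
            GaugeField.gaugeAct (g₀ (j + 1)) (Averaging.iter (fun k => blockAvg (P := F.P K) (j := k) ℰp) (j + 1) U₁)) →
        (∀ X : GaugeField (F.P K) 0 SU2, Averaging.iter (fun k => blockAvg (P := F.P K) (j := k) ℰp) (K - J) (GaugeField.gaugeAct (fun x => (g 0 x)⁻¹) X) =
          Averaging.iter (fun k => blockAvg (P := F.P K) (j := k) ℰp) (K - J) X) →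
        (∀ X : GaugeField (F.P K) 0 SU2, Averaging.iter (fun k => blockAvg (P := F.P K) (j := k) ℰp) (K - J) (GaugeField.gaugeAct (g₀ 0) X) =
          Averaging.iter (fun k => blockAvg (P := F.P K) (j := k) ℰp) (K - J) X) →
        U₀ = GaugeField.gaugeAct (fun x => (g 0 x)⁻¹ * g₀ 0 x) U₁ →
        ∀ i, 1 ≤ i → i < K - J → ∀ e : PBond (F.P K) i,
          ‖logVec (su2Quat (GaugeField.gaugeAct (g i) (Averaging.iter (fun k => blockAvg (P := F.P K) (j := k) ℰp) i W) e))‖ ≤ 1 / 4 ∧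
          ‖logVec (su2Quat (GaugeField.gaugeAct (g₀ i) (Averaging.iter (fun k => blockAvg (P := F.P K) (j := k) ℰp) i U₁) e))‖ ≤ 1 / 4 := by
  obtain ⟨γ₁, hγ₁, H⟩ := arcProfile_of_smallBond L hL b₀ p₀ hb hp
  refine ⟨γ₁, hγ₁, ?_⟩
  intro F γ hFL hγ hγ₁' J K hJK V hV W U₀ hWf hWg hU₀f hU₀g wt lift U₁ g g₀ hwt hlift hT1 hT4 hT5 hT1' hT4' hT5' hT6 hT5r hU₀
  -- the residual transformation `w := g_0⁻¹·g₀_0` and `U₁ = w⁻¹ • U₀`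
  have hwres : ∀ X : GaugeField (F.P K) 0 SU2,
      descendTo F ℰp J K hJK (GaugeField.gaugeAct (fun x => (g 0 x)⁻¹ * g₀ 0 x) X) = descendTo F ℰp J K hJK X := by
    refine residual_of_iter_eq F hJK _ fun X => ?_
    have e1 : GaugeField.gaugeAct (fun x => (g 0 x)⁻¹ * g₀ 0 x) X =
        GaugeField.gaugeAct (fun x => (g 0 x)⁻¹) (GaugeField.gaugeAct (g₀ 0) X) := gaugeAct_mul_eq (fun x => (g 0 x)⁻¹) (g₀ 0) X
    rw [e1, hT6, hT5r]
  have hU₁f : U₁ ∈ fibre F ℰp J K hJK V := by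
    rw [← gaugeAct_mem_fibre_iff_of_residual F hJK hwres U₁, ← hU₀]; exact hU₀f
  have hU₁g : U₁ ∈ histGood F ℰp (θBal F.L γ b₀ p₀) K J := by
    rw [← gaugeAct_mem_histGood_iff F (fun x => (g 0 x)⁻¹ * g₀ 0 x) (θBal F.L γ b₀ p₀) J U₁, ← hU₀]; exact hU₀g
  exact H F γ hFL hγ hγ₁' J K hJK V hV W U₁ hWf hWg hU₁f hU₁g wt lift g g₀ hwt hlift hT1 hT4 hT5 hT1' hT4' hT5'

end Summit.QuantumFields.YangMills.Theorems.FluctuationComparisonRegPrIntLS2BetaLiftLadderArcProfile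

end
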